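import Summits.ValiantsHypothesis.ValiantsHypothesis.Theorems.KPlusLogSqLawTropicalShiftThreeDefs

/-!
# Route «KPlusLogSqLaw» — SHIFT-THREE, part 1: per-entry scores and the domination inequalities

HONEST FRAMING.  Proof file (pure theorems) of the helper chain toward the registered stub `stub_liftRungThree` of the
crux `Summit.ValiantsHypothesis.ValiantsHypothesis.Theses.KPlusLogSqLaw.Lifting` (item `stmt-ValiantsHypothesis-19772`,
route `KPlusLogSqLaw`, cell `pub-symmetroid`, seat val-sym-lift-p3, 2026-08-26); the design is described in the
definitions file `…TropicalShiftThreeDefs.lean`.  Nothing here asserts `Lifting`, `TropicalB`, `KPlusLogSqLaw`,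
`MatrixDescartes` or anything about `VP ≠ VNP`.

THE ARGUMENT.  The KEY IDENTITY `Σ_b shift(σ b, b) = m·#{b : σ b < b}` (every permutation `σ`; `shift = σ b − b + m·[σ b < b]`
and `Σ_b σ b = Σ_b b`) makes the huge class-`2` reward `θ·D·#wraps`, `D = m(2m+3)`, redistributable as `θ(2m+3)·shift` per
entry (`sum_redistribute`): the tropical weight of ANY Leibniz term is `Σ_b φ_θ(σ b, b, λ b)` for the corrected per-entry
score `φ` (`tropWeight_eq_sum_phi`).  For a PRESENT entry `φ = g_θ(q) + [class 1]·(θ − price(q, b))` with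
`g_θ(q) = θ(2m+3)q − pen q` (`phi_present`); the grid term's entry in column `b` has shift `p` and scores
`g_θ(p) + [b < a]·(θ − price(p, b))` (`phi_cterm`).  At `θ = θ(p,a) = L·p + 2a + 1`:
`g(p) − g(q) = (2m+3)(p − q)(θ − (m+1)(p+q+1))` (`gval_sub`) exceeds `L·(p − q)` for `q < p` and is positive for `q > p`
(`gval_gap_of_lt/gt`, using `a ≤ m − p`), while the class-`1` bonus changes by at most the price difference `L·(p − q)`
(`bonus_le_of_lt/gt/eq`; `θ − price(p,b) = 2(a − b) − 1` is odd, so the grid class is the unique best class).  Hence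
(`phi_le`, `phi_lt`): every present entry of column `b` scores at most the grid term's entry, strictly unless it IS that
entry.  Part 2 (`…TropicalShiftThreeChain.lean`) sums this into dominance and runs the chain.
-/

set_option linter.dupNamespace false
set_option autoImplicit false

namespace Summit.ValiantsHypothesis.ValiantsHypothesis.Theorems.LacunarySymmetroidMatrixDescartes.TropicalCensus

open Summit.ValiantsHypothesis.ValiantsHypothesis.Theorems.MatrixDescartes.Negative
open scoped BigOperators
open Finset

namespace ShiftThree

variable (n : ℕ)

/-! ### elementary facts -/

/-- `d 0 = 0`. -/
theorem dd_zero : dd n 0 = 0 := rfl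
/-- `d 1 = 1`. -/
theorem dd_one : dd n 1 = 1 := rfl
/-- `d 2 = D`. -/
theorem dd_two : dd n 2 = bigD n := rfl

/-- value of the phase permutation: `σ_p b = b + p`, reduced mod `m`. -/
theorem rot_val (p : ℕ) (hp : p ≤ n) (b : Fin (n + 1)) :
    ((rot n p b : Fin (n + 1)) : ℕ) = if n + 1 ≤ (b : ℕ) + p then (b : ℕ) + p - (n + 1) else (b : ℕ) + p := by
  have hmod : p % (n + 1) = p := Nat.mod_eq_of_lt (by omega)
  unfold rot
  rw [Equiv.coe_addRight, Fin.val_add_eq_ite]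
  simp only [hmod]

/-- every entry of `σ_p` has shift `p`. -/
theorem shiftZ_rot (p : ℕ) (hp : p ≤ n) (b : Fin (n + 1)) : shiftZ n (rot n p b) b = p := by
  unfold shiftZ
  rw [rot_val n p hp]
  split_ifs with h1 h2 h2 <;> omega

/-- the shift determines the row: an entry of column `b` with shift `p` is the phase-`p` entry. -/
theorem eq_rot_of_shiftZ_eq (p : ℕ) (hp : p ≤ n) (a b : Fin (n + 1)) (h : shiftZ n a b = p) : a = rot n p b := by
  apply Fin.ext
  rw [rot_val n p hp]
  unfold shiftZ at h
  by_cases h1 : (a : ℕ) < (b : ℕ)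
  · rw [if_pos h1] at h
    by_cases h2 : n + 1 ≤ (b : ℕ) + p
    · rw [if_pos h2]; omega
    · rw [if_neg h2]; omega
  · rw [if_neg h1] at h
    by_cases h2 : n + 1 ≤ (b : ℕ) + p
    · rw [if_pos h2]; omega
    · rw [if_neg h2]; omega

/-- **zero-sum redistribution**: `Σ_b ((2m+3)·shift(σ b, b) − D·[σ b < b]) = 0` for every permutation. -/
theorem sum_redistribute (σ : Equiv.Perm (Fin (n + 1))) :
    ∑ b, ((2 * n + 5 : ℤ) * shiftZ n (σ b) b - (bigD n : ℤ) * (if ((σ b : Fin (n + 1)) : ℕ) < (b : ℕ) then 1 else 0)) = 0 := by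
  have h1 : ∀ b, ((2 * n + 5 : ℤ) * shiftZ n (σ b) b -
      (bigD n : ℤ) * (if ((σ b : Fin (n + 1)) : ℕ) < (b : ℕ) then 1 else 0))
      = (2 * n + 5 : ℤ) * (((σ b : Fin (n + 1)) : ℕ) : ℤ) - (2 * n + 5 : ℤ) * ((b : ℕ) : ℤ) := by
    intro b
    unfold shiftZ bigD
    push_cast
    split_ifs with h <;> ring
  rw [Finset.sum_congr rfl (fun b _ => h1 b), Finset.sum_sub_distrib]
  have h2 : ∑ b, (2 * n + 5 : ℤ) * (((σ b : Fin (n + 1)) : ℕ) : ℤ) = ∑ b : Fin (n + 1), (2 * n + 5 : ℤ) * ((b : ℕ) : ℤ) :=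
    Equiv.sum_comp σ (fun b : Fin (n + 1) => (2 * n + 5 : ℤ) * ((b : ℕ) : ℤ))
  rw [h2, sub_self]

/-- the tropical weight is the sum of the corrected per-entry scores. -/
theorem tropWeight_eq_sum_phi (θ : ℤ) (q : Equiv.Perm (Fin (n + 1)) × (Fin (n + 1) → Fin 3)) :
    tropWeight (dd n) (vv n) θ q = ∑ b, phi n θ (q.1 b) b (q.2 b) := by
  unfold tropWeight phi
  have h0 := sum_redistribute n q.1
  rw [Finset.sum_sub_distrib, Finset.sum_add_distrib, Finset.sum_sub_distrib, ← Finset.mul_sum]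
  have h3 : ∑ b, θ * (2 * n + 5 : ℤ) * shiftZ n (q.1 b) b -
      ∑ b, θ * (bigD n : ℤ) * (if ((q.1 b : Fin (n + 1)) : ℕ) < (b : ℕ) then 1 else 0) = 0 := by
    rw [← Finset.sum_sub_distrib]
    have : ∀ b, θ * (2 * n + 5 : ℤ) * shiftZ n (q.1 b) b -
        θ * (bigD n : ℤ) * (if ((q.1 b : Fin (n + 1)) : ℕ) < (b : ℕ) then 1 else 0)
        = θ * ((2 * n + 5 : ℤ) * shiftZ n (q.1 b) b -
          (bigD n : ℤ) * (if ((q.1 b : Fin (n + 1)) : ℕ) < (b : ℕ) then 1 else 0)) := fun b => by ring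
    rw [Finset.sum_congr rfl (fun b _ => this b), ← Finset.mul_sum, h0, mul_zero]
  linarith


/-! ### per-entry scores -/

/-- score of a PRESENT entry: `g_θ(shift) + [class 1]·(θ − price)`. -/
theorem phi_present (θ : ℤ) (a b : Fin (n + 1)) (l : Fin 3) (h : ee n a b l ≠ 0) :
    phi n θ a b l = gval n θ (shiftZ n a b) + (if l = 1 then θ - price n (shiftZ n a b) b else 0) := by
  unfold phi gval vv
  unfold ee at h
  by_cases hw : (a : ℕ) < (b : ℕ)
  · rw [if_pos hw] at h
    have hl : l = 2 := by
      by_contra hl; exact h (by rw [if_neg hl])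
    subst hl
    rw [if_pos hw, dd_two, if_neg (by decide), if_neg (by decide)]
    ring
  · rw [if_neg hw] at h
    have hl : l ≠ 2 := by
      rintro rfl; exact h (by rw [if_neg (by decide), if_neg (by decide)])
    rw [if_neg hw]
    rcases (by fin_cases l <;> simp : l = 0 ∨ l = 1 ∨ l = 2) with rfl | rfl | rfl
    · rw [dd_zero, if_neg (by decide), if_neg (by decide)]
      push_cast; ring
    · rw [dd_one, if_pos rfl, if_pos rfl]
      push_cast; ring
    · exact absurd rfl hl

/-- `phaseSign p = ±1`, in particular nonzero. -/
theorem phaseSign_ne_zero (p : ℕ) : phaseSign n p ≠ 0 := by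
  unfold phaseSign
  exact mul_ne_zero (pow_ne_zero _ (by norm_num)) (Units.ne_zero _)

/-- the sign of the grid term's entry in column `b`. -/
theorem ee_cterm (p a : ℕ) (hp : p ≤ n) (ha : a + p ≤ n + 1) (b : Fin (n + 1)) :
    ee n (rot n p b) b (lam n p a b) =
      (if (b : ℕ) < a then -1 else 1) * (if (b : ℕ) = n ∧ p ≠ 0 then phaseSign n p else 1) := by
  have hv := rot_val n p hp b
  unfold ee lam
  by_cases hw : n + 1 ≤ (b : ℕ) + p
  · rw [if_pos hw] at hv
    have hlt : ((rot n p b : Fin (n + 1)) : ℕ) < (b : ℕ) := by rw [hv]; omega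
    rw [if_pos hlt, if_pos hw, if_pos rfl, if_neg (show ¬ ((b : ℕ) < a) by omega), one_mul]
    by_cases hb : (b : ℕ) = n
    · have hp0 : p ≠ 0 := by omega
      rw [if_pos hb, if_pos ⟨hb, hp0⟩, hv, hb]
      congr 1; omega
    · rw [if_neg hb, if_neg (fun h => hb h.1)]
  · rw [if_neg hw] at hv
    have hlt : ¬ ((rot n p b : Fin (n + 1)) : ℕ) < (b : ℕ) := by rw [hv]; omega
    rw [if_neg hlt, if_neg hw, if_neg (show ¬ ((b : ℕ) = n ∧ p ≠ 0) by omega), mul_one]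
    by_cases hb : (b : ℕ) < a
    · rw [if_pos hb, if_pos hb, if_neg (by decide), if_pos rfl]
    · rw [if_neg hb, if_neg hb, if_pos rfl]

/-- every entry of a grid term is present. -/
theorem ee_cterm_ne_zero (p a : ℕ) (hp : p ≤ n) (ha : a + p ≤ n + 1) (b : Fin (n + 1)) :
    ee n (rot n p b) b (lam n p a b) ≠ 0 := by
  rw [ee_cterm n p a hp ha]
  refine mul_ne_zero ?_ ?_
  · split_ifs <;> norm_num
  · split_ifs
    · exact phaseSign_ne_zero n p
    · norm_num

/-- the grid class map takes class `1` exactly on the columns `b < a`. -/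
theorem lam_eq_one_iff (p a : ℕ) (ha : a + p ≤ n + 1) (b : Fin (n + 1)) :
    lam n p a b = 1 ↔ (b : ℕ) < a := by
  unfold lam
  by_cases hw : n + 1 ≤ (b : ℕ) + p
  · rw [if_pos hw]
    constructor
    · intro h; exact absurd h (by decide)
    · intro h; omega
  · rw [if_neg hw]
    by_cases hb : (b : ℕ) < a
    · rw [if_pos hb]; exact ⟨fun _ => hb, fun _ => rfl⟩
    · rw [if_neg hb]
      constructor
      · intro h; exact absurd h (by decide)
      · intro h; exact absurd h hb

/-- score of the grid term's entry in column `b`. -/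
theorem phi_cterm (θ : ℤ) (p a : ℕ) (hp : p ≤ n) (ha : a + p ≤ n + 1) (b : Fin (n + 1)) :
    phi n θ (rot n p b) b (lam n p a b) = gval n θ p + (if (b : ℕ) < a then θ - price n p b else 0) := by
  rw [phi_present n θ _ b _ (ee_cterm_ne_zero n p a hp ha b), shiftZ_rot n p hp]
  by_cases hb : (b : ℕ) < a
  · rw [if_pos ((lam_eq_one_iff n p a ha b).mpr hb), if_pos hb]
  · rw [if_neg (fun h => hb ((lam_eq_one_iff n p a ha b).mp h)), if_neg hb]

/-! ### the domination inequalities (pure arithmetic) -/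

/-- difference of shift scores, factored: `g(p) − g(q) = (2m+3)(p − q)(θ − (m+1)(p+q+1))`. -/
theorem gval_sub (θ p q : ℤ) :
    gval n θ p - gval n θ q = (2 * n + 5) * (p - q) * (θ - (n + 2) * (p + q + 1)) := by
  unfold gval pen; ring

/-- a smaller shift loses more than `L·(p − q)`. -/
theorem gval_gap_of_lt (p a : ℕ) (q : ℤ) (hq : q < p) :
    (2 * n + 4) * ((p : ℤ) - q) < gval n (th n p a) p - gval n (th n p a) q := by
  rw [gval_sub]
  unfold th
  have h1 : (1 : ℤ) ≤ (p : ℤ) - q := by linarith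
  have hE : (0 : ℤ) ≤ (n + 2) * ((p : ℤ) - q - 1) + 2 * a := by positivity
  have h2 : (2 * n + 4 : ℤ) * p + 2 * a + 1 - (n + 2) * (p + q + 1)
      = 1 + ((n + 2) * ((p : ℤ) - q - 1) + 2 * a) := by ring
  rw [h2]
  nlinarith [mul_nonneg (mul_nonneg (show (0:ℤ) ≤ 2 * n + 5 by positivity) (show (0:ℤ) ≤ (p:ℤ) - q by linarith)) hE]

/-- a larger shift loses outright. -/
theorem gval_gap_of_gt (p a : ℕ) (ha : a + p ≤ n + 1) (q : ℤ) (hq : (p : ℤ) < q) :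
    0 < gval n (th n p a) p - gval n (th n p a) q := by
  rw [gval_sub]
  unfold th
  have h1 : (1 : ℤ) ≤ q - p := by linarith
  have hap : (a : ℤ) + p ≤ n + 1 := by exact_mod_cast ha
  have hF : (1 : ℤ) ≤ (n + 2) * ((p : ℤ) + q + 1) - ((2 * n + 4) * p + 2 * a + 1) := by nlinarith
  have h2 : (2 * n + 5 : ℤ) * (p - q) * ((2 * n + 4) * p + 2 * a + 1 - (n + 2) * (p + q + 1))
      = (2 * n + 5) * (q - p) * ((n + 2) * ((p : ℤ) + q + 1) - ((2 * n + 4) * p + 2 * a + 1)) := by ring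
  rw [h2]
  have h3 : (0 : ℤ) < 2 * n + 5 := by positivity
  positivity

/-- price difference between shifts. -/
theorem price_sub (p q : ℤ) (b : Fin (n + 1)) : price n p b - price n q b = (2 * n + 4) * (p - q) := by
  unfold price; ring

/-- at `θ(p,a)` the class-`1` bonus of a phase-`p` entry in column `b` is `2(a − b) − 1` (odd, never zero). -/
theorem th_sub_price (p a : ℕ) (b : Fin (n + 1)) :
    th n p a - price n p b = 2 * ((a : ℤ) - b) - 1 := by
  unfold th price; ring

/-- bonus comparison, rival shift below the phase. -/
theorem bonus_le_of_lt (p a : ℕ) (b : Fin (n + 1)) (l : Fin 3) (q : ℤ) (hq : q < p) :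
    (if l = 1 then th n p a - price n q b else 0) ≤
      (if (b : ℕ) < a then th n p a - price n p b else 0) + (2 * n + 4) * ((p : ℤ) - q) := by
  have hΔ : (0 : ℤ) ≤ (2 * n + 4) * ((p : ℤ) - q) :=
    mul_nonneg (by positivity) (by linarith)
  have hq' : th n p a - price n q b = (th n p a - price n p b) + (2 * n + 4) * ((p : ℤ) - q) := by
    have := price_sub n p q b; linarith
  have ht := th_sub_price n p a b
  by_cases h1 : l = 1
  · rw [if_pos h1, hq']
    by_cases h2 : (b : ℕ) < a
    · rw [if_pos h2]
    · rw [if_neg h2]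
      have : (a : ℤ) ≤ b := by exact_mod_cast Nat.le_of_not_lt h2
      linarith
  · rw [if_neg h1]
    by_cases h2 : (b : ℕ) < a
    · rw [if_pos h2]
      have : (b : ℤ) + 1 ≤ a := by exact_mod_cast h2
      linarith
    · rw [if_neg h2]; linarith

/-- bonus comparison, rival shift above the phase. -/
theorem bonus_le_of_gt (p a : ℕ) (b : Fin (n + 1)) (l : Fin 3) (q : ℤ) (hq : (p : ℤ) < q) :
    (if l = 1 then th n p a - price n q b else 0) ≤
      (if (b : ℕ) < a then th n p a - price n p b else 0) := by
  have hΔ : (0 : ℤ) < (2 * n + 4) * (q - (p : ℤ)) := mul_pos (by positivity) (by linarith)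
  have hq' : th n p a - price n q b = (th n p a - price n p b) - (2 * n + 4) * (q - (p : ℤ)) := by
    have := price_sub n p q b; linarith
  have ht := th_sub_price n p a b
  by_cases h1 : l = 1
  · rw [if_pos h1, hq']
    by_cases h2 : (b : ℕ) < a
    · rw [if_pos h2]; linarith
    · rw [if_neg h2]
      have : (a : ℤ) ≤ b := by exact_mod_cast Nat.le_of_not_lt h2
      linarith
  · rw [if_neg h1]
    by_cases h2 : (b : ℕ) < a
    · rw [if_pos h2]
      have : (b : ℤ) + 1 ≤ a := by exact_mod_cast h2
      linarith
    · rw [if_neg h2]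

/-- bonus comparison, same shift. -/
theorem bonus_le_of_eq (p a : ℕ) (b : Fin (n + 1)) (l : Fin 3) :
    (if l = 1 then th n p a - price n p b else 0) ≤
      (if (b : ℕ) < a then th n p a - price n p b else 0) := by
  have ht := th_sub_price n p a b
  by_cases h1 : l = 1
  · rw [if_pos h1]
    by_cases h2 : (b : ℕ) < a
    · rw [if_pos h2]
    · rw [if_neg h2]
      have : (a : ℤ) ≤ b := by exact_mod_cast Nat.le_of_not_lt h2
      linarith
  · rw [if_neg h1]
    by_cases h2 : (b : ℕ) < a
    · rw [if_pos h2]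
      have : (b : ℤ) + 1 ≤ a := by exact_mod_cast h2
      linarith
    · rw [if_neg h2]

end ShiftThree

end Summit.ValiantsHypothesis.ValiantsHypothesis.Theorems.LacunarySymmetroidMatrixDescartes.TropicalCensus
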